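import Mathlib.Probability.Distributions.Poisson.Basic
import Mathlib.Analysis.SpecialFunctions.Exp
import HarnessLib

/-!
# Kingman's extended Poisson laws `𝒫(μ)`, `0 ≤ μ ≤ ∞`, on `ℕ∞`

J. F. C. Kingman, *Poisson Processes* (Oxford, 1993), §1.2, p. 4, extends the Poisson
distribution `𝒫(μ)` to the boundary cases: "`𝒫(0)` will mean the distribution concentrated at
`0`" (1.6) "and `𝒫(∞)` the distribution concentrated at `+∞`" (1.7). Mathlib's
`ProbabilityTheory.poissonMeasure r` (`r : ℝ≥0`) is a measure on `ℕ`; here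

* `extPoissonMeasure a` (`a : ℝ≥0∞`) is Kingman's `𝒫(a)` realised as a probability measure on
  `ℕ∞`: the image of `poissonMeasure a.toNNReal` under `ℕ ↪ ℕ∞` for `a < ∞`, and `δ_⊤` for
  `a = ∞` (`poissonMeasure_zero : poissonMeasure 0 = δ₀` shows (1.6) is automatic);
* the distribution-function facts behind Kingman's Countable Additivity Theorem (§1.2, p. 5;
  file `PoissonCountableAdditivity`): `poissonMeasure r {0,…,k} = Σ_{j≤k} e^{-r} rʲ/j!` is
  continuous in `r` and tends to `0` as `r → ∞` ("`Σ_{k≤r} π_k(σₙ) → 0`"), and two probability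
  laws on `ℕ∞` that agree on the events `{· ≤ k}`, `k : ℕ`, are equal.
-/

noncomputable section

open MeasureTheory ProbabilityTheory Set Filter
open scoped ENNReal NNReal Topology Nat

namespace Literature.Probability.Distributions

/-- `poissonMeasure 0 = δ₀`: Kingman's convention (1.6) holds for Mathlib's Poisson law of
rate `0`. [cite: Kingman1993, §1.2 (1.6), p. 4] -/
theorem poissonMeasure_zero : poissonMeasure 0 = Measure.dirac 0 := by
  refine Measure.ext_of_singleton fun n ↦ ?_
  rw [poissonMeasure_singleton, Measure.dirac_apply' _ (measurableSet_singleton n)]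
  cases n with
  | zero => simp
  | succ n => simp

/-- **Kingman's extended Poisson law** `𝒫(a)`, `0 ≤ a ≤ ∞`, as a probability measure on `ℕ∞`:
for `a < ∞` the Poisson law of mean `a` (pushed along `ℕ ↪ ℕ∞`), and for `a = ∞` the point
mass at `⊤` ("`𝒫(∞)` the distribution concentrated at `+∞`").
[cite: Kingman1993, §1.2 (1.6)–(1.7), p. 4] -/
def extPoissonMeasure (a : ℝ≥0∞) : Measure ℕ∞ :=
  if a = ∞ then Measure.dirac ⊤ else (poissonMeasure a.toNNReal).map ((↑) : ℕ → ℕ∞)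

/-- `𝒫(∞) = δ_⊤`. [cite: Kingman1993, §1.2 (1.7), p. 4] -/
theorem extPoissonMeasure_top : extPoissonMeasure ∞ = Measure.dirac ⊤ := if_pos rfl

/-- For `a < ∞`, `𝒫(a)` is the Poisson law of mean `a` on `ℕ ⊆ ℕ∞`.
[cite: Kingman1993, §1.2 (1.3), p. 3] -/
theorem extPoissonMeasure_of_ne_top {a : ℝ≥0∞} (ha : a ≠ ∞) :
    extPoissonMeasure a = (poissonMeasure a.toNNReal).map ((↑) : ℕ → ℕ∞) := if_neg ha

/-- `𝒫(r)` for `r : ℝ≥0`. [cite: Kingman1993, §1.2 (1.3), p. 3] -/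
theorem extPoissonMeasure_coe (r : ℝ≥0) :
    extPoissonMeasure r = (poissonMeasure r).map ((↑) : ℕ → ℕ∞) := by
  rw [extPoissonMeasure_of_ne_top ENNReal.coe_ne_top, ENNReal.toNNReal_coe]

/-- `𝒫(0) = δ₀`. [cite: Kingman1993, §1.2 (1.6), p. 4] -/
theorem extPoissonMeasure_zero : extPoissonMeasure 0 = Measure.dirac 0 := by
  rw [← ENNReal.coe_zero, extPoissonMeasure_coe, poissonMeasure_zero,
    Measure.map_dirac' measurable_from_top]
  rfl

/-- `𝒫(a)` is a probability law. [cite: Kingman1993, §1.2, p. 4] -/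
instance isProbabilityMeasure_extPoissonMeasure (a : ℝ≥0∞) :
    IsProbabilityMeasure (extPoissonMeasure a) := by
  unfold extPoissonMeasure
  split_ifs
  · infer_instance
  · exact Measure.isProbabilityMeasure_map (Measurable.of_discrete).aemeasurable

/-- `𝒫(∞)` gives no mass to `{· ≤ k}`, `k : ℕ`. [cite: Kingman1993, §1.2 (1.7), p. 4] -/
theorem extPoissonMeasure_top_Iic (k : ℕ) : extPoissonMeasure ∞ (Iic (k : ℕ∞)) = 0 := by
  rw [extPoissonMeasure_top, Measure.dirac_apply' _ MeasurableSet.of_discrete]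
  simp

/-- `𝒫(r){· ≤ k} = Po(r){0,…,k}` for `r : ℝ≥0`. [cite: Kingman1993, §1.2, p. 4] -/
theorem extPoissonMeasure_coe_Iic (r : ℝ≥0) (k : ℕ) :
    extPoissonMeasure r (Iic (k : ℕ∞)) = poissonMeasure r (Iic k) := by
  rw [extPoissonMeasure_coe, Measure.map_apply measurable_from_top MeasurableSet.of_discrete]
  congr 1
  ext n
  simp

/-- The Poisson distribution function: `Po(r){0,…,k} = Σ_{j ≤ k} e^{-r} rʲ / j!`
("`P{Sₙ ≤ r} = Σ_{k=0}^r π_k(σₙ)`"). [cite: Kingman1993, §1.2, p. 5] -/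
theorem poissonMeasure_Iic (r : ℝ≥0) (k : ℕ) :
    poissonMeasure r (Iic k) =
      ENNReal.ofReal (∑ j ∈ Finset.range (k + 1), Real.exp (-r) * r ^ j / j !) := by
  have hI : (Iic k : Set ℕ) = ↑(Finset.range (k + 1)) := by
    ext j
    simp
  rw [hI, ← sum_measure_singleton, ENNReal.ofReal_sum_of_nonneg (fun j _ ↦ by positivity)]
  exact Finset.sum_congr rfl fun j _ ↦ poissonMeasure_singleton r j

/-- `r ↦ Po(r){0,…,k}` is continuous ("the continuity of `π_k`").
[cite: Kingman1993, §1.2, p. 5] -/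
theorem continuous_poissonMeasure_Iic (k : ℕ) :
    Continuous fun r : ℝ≥0 ↦ poissonMeasure r (Iic k) := by
  simp_rw [poissonMeasure_Iic]
  exact ENNReal.continuous_ofReal.comp (by fun_prop)

/-- `Po(r){0,…,k} → 0` as `r → ∞` ("if `σₙ → ∞`, `e^{-σₙ} Σ_{k≤r} σₙᵏ/k! → 0`").
[cite: Kingman1993, §1.2, p. 5] -/
theorem tendsto_poissonMeasure_Iic_atTop (k : ℕ) :
    Tendsto (fun r : ℝ≥0 ↦ poissonMeasure r (Iic k)) atTop (𝓝 0) := by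
  simp_rw [poissonMeasure_Iic]
  rw [← ENNReal.ofReal_zero]
  refine ENNReal.tendsto_ofReal ?_
  have h (j : ℕ) : Tendsto (fun r : ℝ≥0 ↦ Real.exp (-r) * r ^ j / j !) atTop (𝓝 0) := by
    have h1 : Tendsto (fun r : ℝ≥0 ↦ (r : ℝ) ^ j * Real.exp (-r)) atTop (𝓝 0) :=
      (Real.tendsto_pow_mul_exp_neg_atTop_nhds_zero j).comp
        (NNReal.tendsto_coe_atTop.2 tendsto_id)
    have h2 := h1.div_const (j ! : ℝ)
    rw [zero_div] at h2
    refine h2.congr fun r ↦ ?_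
    ring
  have := tendsto_finsetSum (Finset.range (k + 1)) fun j _ ↦ h j
  rwa [Finset.sum_const_zero] at this

/-- Two probability laws on `ℕ∞` with the same distribution function on `ℕ`
(`μ{· ≤ k} = μ'{· ≤ k}` for all `k : ℕ`) agree on every finite singleton. [folklore] -/
theorem measure_singleton_eq_of_Iic {μ μ' : Measure ℕ∞} [IsFiniteMeasure μ] [IsFiniteMeasure μ']
    (h : ∀ k : ℕ, μ (Iic (k : ℕ∞)) = μ' (Iic (k : ℕ∞))) (k : ℕ) :
    μ {(k : ℕ∞)} = μ' {(k : ℕ∞)} := by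
  cases k with
  | zero =>
    have h0 : ({((0 : ℕ) : ℕ∞)} : Set ℕ∞) = Iic ((0 : ℕ) : ℕ∞) := by
      ext x
      simp
    rw [h0, h 0]
  | succ k =>
    have hsub : Iic (k : ℕ∞) ⊆ Iic ((k + 1 : ℕ) : ℕ∞) :=
      Iic_subset_Iic.2 (by exact_mod_cast k.le_succ)
    have hk : ({((k + 1 : ℕ) : ℕ∞)} : Set ℕ∞) = Iic ((k + 1 : ℕ) : ℕ∞) \ Iic (k : ℕ∞) := by
      ext x
      simp only [mem_singleton_iff, Set.mem_sdiff, mem_Iic, not_le]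
      constructor
      · rintro rfl
        exact ⟨le_rfl, by exact_mod_cast k.lt_succ_self⟩
      · rintro ⟨h1, h2⟩
        refine le_antisymm h1 ?_
        have := Order.add_one_le_of_lt h2
        exact_mod_cast this
    rw [hk, measure_sdiff hsub MeasurableSet.of_discrete.nullMeasurableSet (measure_ne_top _ _),
      measure_sdiff hsub MeasurableSet.of_discrete.nullMeasurableSet (measure_ne_top _ _), h, h]

/-- Two probability laws on `ℕ∞` with the same distribution function on `ℕ` are equal (the mass
at `⊤` is then forced). This is how Kingman reads off "`P{S = r} = π_r(σ)`" and
"`P{S > r} = 1` for all `r`, so `S` diverges with probability 1". [cite: Kingman1993, §1.2, p. 5] -/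
theorem measure_eq_of_Iic {μ μ' : Measure ℕ∞} [IsProbabilityMeasure μ] [IsProbabilityMeasure μ']
    (h : ∀ k : ℕ, μ (Iic (k : ℕ∞)) = μ' (Iic (k : ℕ∞))) : μ = μ' := by
  have hsing := measure_singleton_eq_of_Iic h
  refine Measure.ext_of_singleton fun x ↦ ?_
  induction x using ENat.recTopCoe with
  | top =>
    have hc : ({⊤} : Set ℕ∞) = (⋃ k : ℕ, {(k : ℕ∞)})ᶜ := by
      ext x
      induction x using ENat.recTopCoe with
      | top => simp
      | coe n => simp
    have hd : Pairwise (Function.onFun Disjoint fun k : ℕ ↦ ({(k : ℕ∞)} : Set ℕ∞)) :=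
      fun i j hij ↦ disjoint_singleton.2 (by exact_mod_cast hij)
    rw [hc, measure_compl (MeasurableSet.iUnion fun _ ↦ MeasurableSet.of_discrete)
        (measure_ne_top _ _),
      measure_compl (MeasurableSet.iUnion fun _ ↦ MeasurableSet.of_discrete) (measure_ne_top _ _),
      measure_univ, measure_univ, measure_iUnion hd fun _ ↦ MeasurableSet.of_discrete,
      measure_iUnion hd fun _ ↦ MeasurableSet.of_discrete, tsum_congr hsing]
  | coe k => exact hsing k

end Literature.Probability.Distributions
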